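import Literature.Geometry.GeometricMeasureTheory.BlowUpCycle
import Mathlib.MeasureTheory.Covering.Besicovitch
import Mathlib.MeasureTheory.Covering.BesicovitchVectorSpace
import Mathlib.MeasureTheory.Covering.Differentiation
import Mathlib.Analysis.Normed.Module.Ball.Pointwise
import HarnessLib

/-!
# Almost every point is a good blow-up point

Support file for the proof of the named fact
`Literature.Geometry.GeometricMeasureTheory.Federer1969_compactness_integralCurrents` along
B. White's structure-theorem-free proof of the closure theorem [White1989, pp. 216–217;
Bandara2006, §4.1]. For a finite measure `σ` on `V` and an integrable `(k+1)`-vectorfield `ξ`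
(`T = σ ∧ ξ`) satisfying, `σ`-almost everywhere,

* the **lower density bound** `∫_{𝐁(x,r)} ‖ξ‖ dσ ≥ (βr)^{k+1}` for small `r`
  (for `T` a limit of integral cycles this is [White1989, p. 213 (3)], in the tree
  `Current.lowerDensityBound`), and
* the **upper density bound** `Θ^{*(k+1)}(σ, x) ≤ 1` (for `σ = 𝓢^{k+1} ⌞ M`, Federer 2.10.19 (5), in
  the tree `ae_eventually_sphericalMeasure_inter_closedBall_le`),

we show that `σ`-a.e. point `a` satisfies the hypotheses of the blow-up analysis of
`BlowUpCycle`: `a` is a normalised Lebesgue point of `ξ` (Besicovitch differentiation), a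
normalised density point of one of the closed lower-density sets `lowerDensitySet σ ξ β r₁`
(Besicovitch density theorem), `ξ(a) ≠ 0`, and `σ(𝐁(a,s)) ≤ K s^{k+1}` for all `s > 0`
(**`ae_blowUp_hypotheses`**); moreover every vague limit of blow-ups `σ_{a,λ_l}` at such a point
is non-zero (`blowUpLimit_ne_zero`).

Definitions with bodies (`lowerDensitySet`) and theorems only; no named facts.

## References

* B. White, *A new proof of the compactness theorem for integral currents*, Comment. Math.
  Helv. 64 (1989) 207–220, pp. 213, 216–217 [White1989].
* L. Bandara, *The closure theorem for integral currents without the structure theorem*,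
  B.Sc. thesis, ANU 2006, §4.1 [Bandara2006].
* H. Federer, *Geometric Measure Theory*, Springer 1969, 2.9.8, 2.9.11, 2.10.19 [Federer1969].
-/

noncomputable section

open scoped ENNReal NNReal Topology
open MeasureTheory TopologicalSpace Set Filter Metric Function

namespace Literature.Geometry.GeometricMeasureTheory

-- Nested operator-norm instances on (duals of) `E [⋀^Fin m]→L[ℝ] ℝ`, as in `Currents.lean`.
set_option maxSynthPendingDepth 3

variable {V : Type*} [NormedAddCommGroup V] [InnerProductSpace ℝ V] [FiniteDimensional ℝ V]
  [MeasurableSpace V] [BorelSpace V] {k : ℕ}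

/-! ### The lower-density sets -/

section LowerDensitySet

/-- **The lower-density set** `M(β, r₁) = {x : (βr)^{k+1} ≤ ∫_{𝐁(x,r)} ‖ξ‖ dσ for 0 < r ≤ r₁}`
(i.e. `‖σ ∧ ξ‖(𝐁(x,r)) ≥ (βr)^{k+1}` at all scales up to `r₁`). [cite: White1989, p. 213] -/
def lowerDensitySet (σ : Measure V) (ξ : V → Multivector V (k + 1)) (β r₁ : ℝ) : Set V :=
  {x | ∀ r : ℝ, 0 < r → r ≤ r₁ → (β * r) ^ (k + 1) ≤ ∫ x' in closedBall x r, ‖ξ x'‖ ∂σ}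

omit [FiniteDimensional ℝ V] [BorelSpace V] in
/-- Unfolding `lowerDensitySet`. [cite: White1989, p. 213] -/
theorem mem_lowerDensitySet {σ : Measure V} {ξ : V → Multivector V (k + 1)} {β r₁ : ℝ} {x : V} :
    x ∈ lowerDensitySet σ ξ β r₁ ↔
      ∀ r : ℝ, 0 < r → r ≤ r₁ → (β * r) ^ (k + 1) ≤ ∫ x' in closedBall x r, ‖ξ x'‖ ∂σ :=
  Iff.rfl

omit [InnerProductSpace ℝ V] [FiniteDimensional ℝ V] in
/-- **Upper semicontinuity of `x ↦ μ(𝐁(x,r))`**: the superlevel sets `{x : c ≤ μ(𝐁(x,r))}` of a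
finite measure are closed. [cite: Federer1969, 2.9.11] -/
theorem isClosed_setOf_le_measure_closedBall [NormedSpace ℝ V] (μ : Measure V) [IsFiniteMeasure μ]
    (c : ℝ≥0∞) {r : ℝ} (hr : 0 ≤ r) : IsClosed {x : V | c ≤ μ (closedBall x r)} := by
  refine IsSeqClosed.isClosed fun u x hu hux => ?_
  change c ≤ μ (closedBall x r)
  have hlim : Tendsto (fun δ : ℝ => μ (cthickening δ (closedBall x r))) (𝓝[>] 0)
      (𝓝 (μ (closedBall x r))) :=
    (tendsto_measure_cthickening_of_isClosed ⟨1, one_pos, measure_ne_top μ _⟩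
      isClosed_closedBall).mono_left nhdsWithin_le_nhds
  refine ge_of_tendsto hlim (eventually_nhdsWithin_of_forall fun δ (hδ : 0 < δ) => ?_)
  obtain ⟨N, hN⟩ := (Metric.tendsto_atTop.1 hux) δ hδ
  calc c ≤ μ (closedBall (u N) r) := hu N
    _ ≤ μ (cthickening δ (closedBall x r)) := measure_mono (by
        rw [cthickening_closedBall hδ.le hr]
        exact closedBall_subset_closedBall' (by linarith [(hN N le_rfl).le]))

omit [FiniteDimensional ℝ V] in
/-- `∫_{𝐁(x,r)} ‖ξ‖ dσ = (σ ⌞ ‖ξ‖)(𝐁(x,r))`. [cite: Federer1969, 2.9.8] -/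
theorem setIntegral_norm_eq_withDensity {σ : Measure V} {ξ : V → Multivector V (k + 1)}
    (hξ : Integrable ξ σ) (x : V) (r : ℝ) :
    ∫ x' in closedBall x r, ‖ξ x'‖ ∂σ =
      ((σ.withDensity fun y => ‖ξ y‖ₑ) (closedBall x r)).toReal := by
  rw [withDensity_apply _ measurableSet_closedBall, integral_norm_eq_lintegral_enorm hξ.1.restrict]

omit [FiniteDimensional ℝ V] in
/-- **The lower-density sets are closed.** [cite: White1989, p. 213; Federer1969, 2.9.11] -/
theorem isClosed_lowerDensitySet {σ : Measure V} [IsFiniteMeasure σ]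
    {ξ : V → Multivector V (k + 1)} (hξ : Integrable ξ σ) (β r₁ : ℝ) :
    IsClosed (lowerDensitySet σ ξ β r₁) := by
  set μ' : Measure V := σ.withDensity fun y => ‖ξ y‖ₑ with hμ'
  haveI : IsFiniteMeasure μ' := isFiniteMeasure_withDensity hξ.2.ne
  have heq : lowerDensitySet σ ξ β r₁ = ⋂ r : ℝ, {x : V | 0 < r → r ≤ r₁ →
      ENNReal.ofReal ((β * r) ^ (k + 1)) ≤ μ' (closedBall x r)} := by
    ext x
    simp only [mem_lowerDensitySet, mem_iInter, mem_setOf_eq]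
    refine forall_congr' fun r => imp_congr_right fun _ => imp_congr_right fun _ => ?_
    rw [setIntegral_norm_eq_withDensity hξ, ← hμ',
      ENNReal.ofReal_le_iff_le_toReal (measure_ne_top μ' _)]
  rw [heq]
  refine isClosed_iInter fun r => ?_
  by_cases hr : 0 < r ∧ r ≤ r₁
  · have : {x : V | 0 < r → r ≤ r₁ → ENNReal.ofReal ((β * r) ^ (k + 1)) ≤ μ' (closedBall x r)} =
        {x : V | ENNReal.ofReal ((β * r) ^ (k + 1)) ≤ μ' (closedBall x r)} := by
      ext x; simp [hr.1, hr.2]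
    rw [this]
    exact isClosed_setOf_le_measure_closedBall μ' _ hr.1.le
  · have : {x : V | 0 < r → r ≤ r₁ → ENNReal.ofReal ((β * r) ^ (k + 1)) ≤ μ' (closedBall x r)} =
        univ := by
      ext x
      simp only [mem_setOf_eq, mem_univ, iff_true]
      intro h1 h2
      exact absurd ⟨h1, h2⟩ hr
    rw [this]
    exact isClosed_univ

end LowerDensitySet

/-! ### Almost every point is good -/

section GoodPoints

variable {σ : Measure V} {ξ : V → Multivector V (k + 1)}

omit [InnerProductSpace ℝ V] [FiniteDimensional ℝ V] [BorelSpace V] in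
/-- From a ratio limit `F(r)/σ(𝐁(a,r)) → 0` and the growth `σ(𝐁(a,r)) ≤ 2 α(k+1) r^{k+1}` for small
`r` to the normalised limit `r^{-(k+1)} F(r) → 0`. [cite: Federer1969, 2.9.8] -/
private theorem tendsto_pow_inv_mul_toReal_of_ratio [IsFiniteMeasure σ] {a : V}
    (hspt : a ∈ σ.support)
    (h2 : ∀ᶠ r in 𝓝[>] (0 : ℝ),
      σ (closedBall a r) ≤ 2 * (unitBallVolume (k + 1) * ENNReal.ofReal (r ^ (k + 1))))
    {F : ℝ → ℝ≥0∞} (hF : Tendsto (fun r => F r / σ (closedBall a r)) (𝓝[>] 0) (𝓝 0)) :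
    Tendsto (fun r => (r⁻¹) ^ (k + 1) * (F r).toReal) (𝓝[>] 0) (𝓝 0) := by
  have hpos : ∀ r : ℝ, 0 < r → σ (closedBall a r) ≠ 0 := fun r hr =>
    ((Measure.mem_support_iff_forall a).1 hspt _ (closedBall_mem_nhds a hr)).ne'
  have hE : Tendsto (fun r => ENNReal.ofReal ((r⁻¹) ^ (k + 1)) * F r) (𝓝[>] 0) (𝓝 0) := by
    have hupper : Tendsto (fun r => (F r / σ (closedBall a r)) * (2 * unitBallVolume (k + 1)))
        (𝓝[>] 0) (𝓝 0) := by
      have h := ENNReal.Tendsto.mul_const hF (b := 2 * unitBallVolume (k + 1))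
        (Or.inr (ENNReal.mul_ne_top (by norm_num) (unitBallVolume_ne_top _)))
      rwa [zero_mul] at h
    refine tendsto_of_tendsto_of_tendsto_of_le_of_le' tendsto_const_nhds hupper
      (Eventually.of_forall fun _ => zero_le) ?_
    filter_upwards [h2, self_mem_nhdsWithin] with r hr hr0
    have hr0' : (0 : ℝ) < r := hr0
    have hB0 := hpos r hr0'
    have hBt : σ (closedBall a r) ≠ ⊤ := measure_ne_top σ _
    have hone : ENNReal.ofReal (r ^ (k + 1)) * ENNReal.ofReal ((r⁻¹) ^ (k + 1)) = 1 := by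
      rw [← ENNReal.ofReal_mul (by positivity), ← mul_pow, mul_inv_cancel₀ hr0'.ne', one_pow,
        ENNReal.ofReal_one]
    calc ENNReal.ofReal ((r⁻¹) ^ (k + 1)) * F r
        = (F r / σ (closedBall a r)) * (σ (closedBall a r) * ENNReal.ofReal ((r⁻¹) ^ (k + 1))) := by
          rw [← mul_assoc, ENNReal.div_mul_cancel hB0 hBt, mul_comm]
      _ ≤ (F r / σ (closedBall a r)) *
          ((2 * (unitBallVolume (k + 1) * ENNReal.ofReal (r ^ (k + 1)))) *
            ENNReal.ofReal ((r⁻¹) ^ (k + 1))) := by gcongr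
      _ = (F r / σ (closedBall a r)) * (2 * unitBallVolume (k + 1)) := by
          rw [mul_assoc 2, mul_assoc (unitBallVolume _), hone, mul_one]
  have h := (ENNReal.tendsto_toReal ENNReal.zero_ne_top).comp hE
  rw [ENNReal.toReal_zero] at h
  refine h.congr' ?_
  filter_upwards [self_mem_nhdsWithin] with r hr
  have hr' : (0 : ℝ) < r := hr
  simp only [comp_apply]
  rw [ENNReal.toReal_mul, ENNReal.toReal_ofReal (by positivity : (0 : ℝ) ≤ (r⁻¹) ^ (k + 1))]

/-- **Normalised Lebesgue points** (Besicovitch differentiation + `Θ* ≤ 1`): for `σ`-a.e. `a`,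
`r^{-(k+1)} ∫_{𝐁(a,r)} ‖ξ − ξ(a)‖ dσ → 0`. [cite: Federer1969, 2.9.8; White1989, p. 216] -/
theorem ae_tendsto_setIntegral_norm_sub [IsFiniteMeasure σ] (hξ : Integrable ξ σ)
    (hup : ∀ᵐ x ∂σ, ∀ t : ℝ≥0∞, 1 < t → ∀ᶠ r in 𝓝[>] (0 : ℝ),
      σ (closedBall x r) ≤ t * (unitBallVolume (k + 1) * ENNReal.ofReal (r ^ (k + 1)))) :
    ∀ᵐ a ∂σ, Tendsto (fun r => (r⁻¹) ^ (k + 1) * ∫ x in closedBall a r, ‖ξ x - ξ a‖ ∂σ)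
      (𝓝[>] 0) (𝓝 0) := by
  have hLeb := (Besicovitch.vitaliFamily σ).ae_tendsto_lintegral_enorm_sub_div_of_integrable hξ
  filter_upwards [hLeb, hup, (Measure.support_mem_ae : σ.support ∈ ae σ)] with a ha hupa hspt
  have ha' : Tendsto (fun r => (∫⁻ y in closedBall a r, ‖ξ y - ξ a‖ₑ ∂σ) / σ (closedBall a r))
      (𝓝[>] 0) (𝓝 0) := ha.comp (Besicovitch.tendsto_filterAt σ a)
  have h2 := hupa 2 (by norm_num)
  have h := tendsto_pow_inv_mul_toReal_of_ratio hspt h2 ha'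
  refine h.congr' (Eventually.of_forall fun r => ?_)
  change _ = (r⁻¹) ^ (k + 1) * ∫ x in closedBall a r, ‖ξ x - ξ a‖ ∂σ
  rw [integral_norm_eq_lintegral_enorm (f := fun x => ξ x - ξ a)
    ((hξ.sub (integrable_const (ξ a))).1.restrict)]

/-- **Normalised density points of the lower-density sets** (Besicovitch density theorem +
`Θ* ≤ 1`): for `σ`-a.e. `a` and every `j`, if `a ∈ M(β, 1/(j+1))` then
`r^{-(k+1)} σ(𝐁(a,r) ∖ M(β, 1/(j+1))) → 0`. [cite: Federer1969, 2.9.11; White1989, p. 217] -/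
theorem ae_tendsto_measure_diff_lowerDensitySet [IsFiniteMeasure σ] (hξ : Integrable ξ σ) (β : ℝ)
    (hup : ∀ᵐ x ∂σ, ∀ t : ℝ≥0∞, 1 < t → ∀ᶠ r in 𝓝[>] (0 : ℝ),
      σ (closedBall x r) ≤ t * (unitBallVolume (k + 1) * ENNReal.ofReal (r ^ (k + 1)))) :
    ∀ᵐ a ∂σ, ∀ j : ℕ, a ∈ lowerDensitySet σ ξ β ((j : ℝ) + 1)⁻¹ →
      Tendsto (fun r => (r⁻¹) ^ (k + 1) *
        (σ (closedBall a r \ lowerDensitySet σ ξ β ((j : ℝ) + 1)⁻¹)).toReal) (𝓝[>] 0) (𝓝 0) := by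
  set M : ℕ → Set V := fun j => lowerDensitySet σ ξ β ((j : ℝ) + 1)⁻¹ with hM
  have hMc : ∀ j, IsClosed (M j) := fun j => isClosed_lowerDensitySet hξ β _
  have hd : ∀ᵐ a ∂σ, ∀ j, Tendsto (fun r => σ (M j ∩ closedBall a r) / σ (closedBall a r))
      (𝓝[>] 0) (𝓝 ((M j).indicator 1 a)) :=
    ae_all_iff.2 fun j =>
      Besicovitch.ae_tendsto_measure_inter_div_of_measurableSet σ (hMc j).measurableSet
  filter_upwards [hd, hup, (Measure.support_mem_ae : σ.support ∈ ae σ)] with a hda hupa hspt j haj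
  have hpos : ∀ r : ℝ, 0 < r → σ (closedBall a r) ≠ 0 := fun r hr =>
    ((Measure.mem_support_iff_forall a).1 hspt _ (closedBall_mem_nhds a hr)).ne'
  have h1 : Tendsto (fun r => σ (M j ∩ closedBall a r) / σ (closedBall a r)) (𝓝[>] 0) (𝓝 1) := by
    have h := hda j
    rwa [indicator_of_mem haj, Pi.one_apply] at h
  have hc : Tendsto (fun r => σ (closedBall a r \ M j) / σ (closedBall a r)) (𝓝[>] 0) (𝓝 0) := by
    have hsub := ENNReal.Tendsto.sub (tendsto_const_nhds (x := (1 : ℝ≥0∞))) h1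
      (Or.inl ENNReal.one_ne_top)
    rw [tsub_self] at hsub
    refine hsub.congr' ?_
    filter_upwards [self_mem_nhdsWithin] with r hr
    have hB0 := hpos r hr
    have hBt : σ (closedBall a r) ≠ ⊤ := measure_ne_top σ _
    have hsum : σ (closedBall a r \ M j) + σ (M j ∩ closedBall a r) = σ (closedBall a r) := by
      rw [add_comm, inter_comm]
      exact measure_inter_add_sdiff _ (hMc j).measurableSet
    have hdiff : σ (closedBall a r \ M j) = σ (closedBall a r) - σ (M j ∩ closedBall a r) :=
      ENNReal.eq_sub_of_add_eq (measure_ne_top σ _) hsum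
    rw [hdiff, ENNReal.sub_div fun _ _ => hB0, ENNReal.div_self hB0 hBt]
  exact tendsto_pow_inv_mul_toReal_of_ratio hspt (hupa 2 (by norm_num)) hc

omit [InnerProductSpace ℝ V] [FiniteDimensional ℝ V] [MeasurableSpace V] [BorelSpace V] in
/-- Extracting a radius from an `∀ᶠ r in 𝓝[>] 0` statement. [folklore] -/
private theorem exists_forall_of_eventually_nhdsGT {p : ℝ → Prop} (h : ∀ᶠ r in 𝓝[>] (0 : ℝ), p r) :
    ∃ ε : ℝ, 0 < ε ∧ ∀ r : ℝ, 0 < r → r < ε → p r := by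
  rw [eventually_nhdsWithin_iff, Metric.eventually_nhds_iff] at h
  obtain ⟨ε, hε, h⟩ := h
  exact ⟨ε, hε, fun r hr hrε => h (by rwa [Real.dist_eq, sub_zero, abs_of_pos hr]) hr⟩

/-- **Almost every point is a good blow-up point.** Let `σ` be finite, `ξ` integrable, and
suppose that `σ`-a.e. the lower density bound `(βr)^{k+1} ≤ ∫_{𝐁(x,r)} ‖ξ‖ dσ` holds for small
`r` and `Θ^{*(k+1)}(σ, x) ≤ 1`. Then for `σ`-a.e. `a`: `a` is a normalised Lebesgue point of `ξ`;
`a` lies in some closed lower-density set `M(β, 1/(j+1))` of which it is a normalised density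
point; `ξ(a) ≠ 0`; `σ(𝐁(a,s)) ≤ K s^{k+1}` for all `s > 0` with `K < ∞`; and
`Θ^{*(k+1)}(σ, a) ≤ 1`. These are the hypotheses of `BlowUpCycle`.
[cite: White1989, pp. 216–217; Bandara2006, Lemma 4.1.8; Federer1969, 2.9.8, 2.9.11] -/
theorem ae_blowUp_hypotheses [IsFiniteMeasure σ] (hξ : Integrable ξ σ) {β : ℝ} (hβ : 0 < β)
    (hA : ∀ᵐ x ∂σ, ∀ᶠ r in 𝓝[>] (0 : ℝ), (β * r) ^ (k + 1) ≤ ∫ x' in closedBall x r, ‖ξ x'‖ ∂σ)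
    (hup : ∀ᵐ x ∂σ, ∀ t : ℝ≥0∞, 1 < t → ∀ᶠ r in 𝓝[>] (0 : ℝ),
      σ (closedBall x r) ≤ t * (unitBallVolume (k + 1) * ENNReal.ofReal (r ^ (k + 1)))) :
    ∀ᵐ a ∂σ,
      Tendsto (fun r => (r⁻¹) ^ (k + 1) * ∫ x in closedBall a r, ‖ξ x - ξ a‖ ∂σ) (𝓝[>] 0) (𝓝 0) ∧
      (∃ j : ℕ, a ∈ lowerDensitySet σ ξ β ((j : ℝ) + 1)⁻¹ ∧
        Tendsto (fun r => (r⁻¹) ^ (k + 1) *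
          (σ (closedBall a r \ lowerDensitySet σ ξ β ((j : ℝ) + 1)⁻¹)).toReal) (𝓝[>] 0) (𝓝 0)) ∧
      ξ a ≠ 0 ∧
      (∃ K : ℝ≥0∞, K ≠ ⊤ ∧ ∀ s : ℝ, 0 < s → σ (closedBall a s) ≤ K * ENNReal.ofReal (s ^ (k + 1))) ∧
      (∀ t : ℝ≥0∞, 1 < t → ∀ᶠ r in 𝓝[>] (0 : ℝ),
        σ (closedBall a r) ≤ t * (unitBallVolume (k + 1) * ENNReal.ofReal (r ^ (k + 1)))) := by
  filter_upwards [ae_tendsto_setIntegral_norm_sub hξ hup,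
    ae_tendsto_measure_diff_lowerDensitySet hξ β hup, hA, hup] with a hLeb hdens hAa hupa
  refine ⟨hLeb, ?_, ?_, ?_, hupa⟩
  · -- a lower-density set containing `a`
    obtain ⟨ε, hε, hε'⟩ := exists_forall_of_eventually_nhdsGT hAa
    obtain ⟨j, hj⟩ := exists_nat_one_div_lt hε
    have hjε : ((j : ℝ) + 1)⁻¹ < ε := by rwa [one_div] at hj
    have haj : a ∈ lowerDensitySet σ ξ β ((j : ℝ) + 1)⁻¹ :=
      fun r hr hr1 => hε' r hr (hr1.trans_lt hjε)
    exact ⟨j, haj, hdens j haj⟩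
  · -- `ξ(a) ≠ 0`
    intro h0
    have hLeb0 : Tendsto (fun r => (r⁻¹) ^ (k + 1) * ∫ x in closedBall a r, ‖ξ x‖ ∂σ)
        (𝓝[>] 0) (𝓝 0) := by
      simpa [h0] using hLeb
    have hge : ∀ᶠ r in 𝓝[>] (0 : ℝ), β ^ (k + 1) ≤ (r⁻¹) ^ (k + 1) * ∫ x in closedBall a r, ‖ξ x‖ ∂σ := by
      filter_upwards [hAa, self_mem_nhdsWithin] with r hr hr0
      have hr0' : (0 : ℝ) < r := hr0
      calc β ^ (k + 1) = (r⁻¹) ^ (k + 1) * (β * r) ^ (k + 1) := by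
            rw [mul_pow, mul_comm, mul_assoc, ← mul_pow, mul_inv_cancel₀ hr0'.ne', one_pow, mul_one]
        _ ≤ (r⁻¹) ^ (k + 1) * ∫ x in closedBall a r, ‖ξ x‖ ∂σ :=
            mul_le_mul_of_nonneg_left hr (by positivity)
    have := ge_of_tendsto hLeb0 hge
    exact absurd this (not_le.2 (pow_pos hβ _))
  · -- growth at all scales
    obtain ⟨ε, hε, hε'⟩ := exists_forall_of_eventually_nhdsGT (hupa 2 (by norm_num))
    set K : ℝ≥0∞ := 2 * unitBallVolume (k + 1) + σ univ / ENNReal.ofReal (ε ^ (k + 1)) with hK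
    have hεp : ENNReal.ofReal (ε ^ (k + 1)) ≠ 0 := (ENNReal.ofReal_pos.2 (pow_pos hε _)).ne'
    refine ⟨K, ?_, fun s hs => ?_⟩
    · exact ENNReal.add_ne_top.2 ⟨ENNReal.mul_ne_top (by norm_num) (unitBallVolume_ne_top _),
        (ENNReal.div_lt_top (measure_ne_top σ _) hεp).ne⟩
    rcases lt_or_ge s ε with hsε | hsε
    · calc σ (closedBall a s) ≤ 2 * (unitBallVolume (k + 1) * ENNReal.ofReal (s ^ (k + 1))) :=
            hε' s hs hsε
        _ = (2 * unitBallVolume (k + 1)) * ENNReal.ofReal (s ^ (k + 1)) := by rw [mul_assoc]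
        _ ≤ K * ENNReal.ofReal (s ^ (k + 1)) := by gcongr; exact le_self_add
    · calc σ (closedBall a s) ≤ σ univ := measure_mono (subset_univ _)
        _ = σ univ / ENNReal.ofReal (ε ^ (k + 1)) * ENNReal.ofReal (ε ^ (k + 1)) :=
            (ENNReal.div_mul_cancel hεp ENNReal.ofReal_ne_top).symm
        _ ≤ σ univ / ENNReal.ofReal (ε ^ (k + 1)) * ENNReal.ofReal (s ^ (k + 1)) := by
            gcongr
        _ ≤ K * ENNReal.ofReal (s ^ (k + 1)) := by gcongr; exact le_add_self

end GoodPoints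

/-! ### Vague limits of blow-ups at good points are non-zero -/

section NeZero

variable {σ : Measure V} {ξ : V → Multivector V (k + 1)} {a : V} {lam : ℕ → ℝ} {ν : Measure V}

omit [InnerProductSpace ℝ V] [FiniteDimensional ℝ V] [MeasurableSpace V] [BorelSpace V] in
/-- Rescaling an `o(r^{k+1})` statement along `λ_l ↓ 0`: if `r^{-(k+1)} f(r) → 0` as `r ↓ 0` then
for every `c > 0`, eventually `f(λ_l) ≤ c λ_l^{k+1}`. [folklore] -/
private theorem eventually_le_mul_pow_of_tendsto₀ {f : ℝ → ℝ}
    (hf : Tendsto (fun r => (r⁻¹) ^ (k + 1) * f r) (𝓝[>] 0) (𝓝 0)) (hlam : ∀ l, 0 < lam l)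
    (hlam0 : Tendsto lam atTop (𝓝 0)) {c : ℝ} (hc : 0 < c) :
    ∀ᶠ l in atTop, f (lam l) ≤ c * (lam l) ^ (k + 1) := by
  have hcomp : Tendsto lam atTop (𝓝[>] 0) :=
    tendsto_nhdsWithin_iff.2 ⟨hlam0, Eventually.of_forall hlam⟩
  have h := (hf.comp hcomp).eventually (Iic_mem_nhds hc)
  filter_upwards [h] with l hl
  simp only [comp_apply] at hl
  have htp : 0 < (lam l) ^ (k + 1) := pow_pos (hlam l) _
  calc f (lam l) = (lam l) ^ (k + 1) * (((lam l)⁻¹) ^ (k + 1) * f (lam l)) := by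
        rw [← mul_assoc, ← mul_pow, mul_inv_cancel₀ (hlam l).ne', one_pow, one_mul]
    _ ≤ (lam l) ^ (k + 1) * c := mul_le_mul_of_nonneg_left hl htp.le
    _ = c * lam l ^ (k + 1) := mul_comm _ _

/-- **Vague limits of blow-ups at a good point are non-zero**: if `σ_{a,λ_l} → ν` vaguely,
`a` is a normalised Lebesgue point of `ξ` with `ξ(a) ≠ 0` and the lower density bound
`(βr)^{k+1} ≤ ∫_{𝐁(a,r)} ‖ξ‖ dσ` holds for small `r`, then
`ν(𝐁(0,1)) ≥ β^{k+1} / (2‖ξ(a)‖) > 0`. [cite: White1989, p. 217; Bandara2006, Lemma 4.1.8] -/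
theorem blowUpLimit_ne_zero [IsFiniteMeasure σ] [IsLocallyFiniteMeasure ν]
    (hξ : Integrable ξ σ) (hlam : ∀ l, 0 < lam l) (hlam0 : Tendsto lam atTop (𝓝 0))
    (hv : Measure.VagueTendsto (fun l => Measure.blowUp σ (k + 1) a (lam l)) ν)
    (hLeb : Tendsto (fun r => (r⁻¹) ^ (k + 1) * ∫ x in closedBall a r, ‖ξ x - ξ a‖ ∂σ)
      (𝓝[>] 0) (𝓝 0)) {β : ℝ} (hβ : 0 < β)
    (hAa : ∀ᶠ r in 𝓝[>] (0 : ℝ), (β * r) ^ (k + 1) ≤ ∫ x' in closedBall a r, ‖ξ x'‖ ∂σ)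
    (hξa : ξ a ≠ 0) : ν ≠ 0 := by
  intro hν0
  set σl : ℕ → Measure V := fun l => Measure.blowUp σ (k + 1) a (lam l) with hσl
  have hξa' : 0 < ‖ξ a‖ := norm_pos_iff.2 hξa
  have hξ' : Integrable (fun x => ξ x - ξ a) σ := hξ.sub (integrable_const _)
  have hcomp : Tendsto lam atTop (𝓝[>] 0) :=
    tendsto_nhdsWithin_iff.2 ⟨hlam0, Eventually.of_forall hlam⟩
  have e1 : ∀ᶠ l in atTop, (β * lam l) ^ (k + 1) ≤ ∫ x' in closedBall a (lam l), ‖ξ x'‖ ∂σ :=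
    hcomp.eventually hAa
  have e2 : ∀ᶠ l in atTop, ∫ x in closedBall a (lam l), ‖ξ x - ξ a‖ ∂σ ≤
      (β ^ (k + 1) / 2) * (lam l) ^ (k + 1) :=
    eventually_le_mul_pow_of_tendsto₀ hLeb hlam hlam0 (half_pos (pow_pos hβ (k + 1)))
  set c₀ : ℝ := β ^ (k + 1) / 2 / ‖ξ a‖ with hc₀
  have hc₀p : 0 < c₀ := by positivity
  have key : ∀ᶠ l in atTop, ENNReal.ofReal c₀ ≤ σl l (closedBall 0 1) := by
    filter_upwards [e1, e2] with l h1 h2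
    have ht := hlam l
    have htp : 0 < (lam l) ^ (k + 1) := pow_pos ht _
    set S : Set V := closedBall a (lam l) with hS
    have h7 : ∫ x' in S, ‖ξ x'‖ ∂σ ≤ ‖ξ a‖ * (σ S).toReal + ∫ x' in S, ‖ξ x' - ξ a‖ ∂σ := by
      calc ∫ x' in S, ‖ξ x'‖ ∂σ ≤ ∫ x' in S, (‖ξ a‖ + ‖ξ x' - ξ a‖) ∂σ :=
            integral_mono hξ.norm.integrableOn
              ((integrable_const _).add hξ'.norm.integrableOn) fun x' =>
              norm_le_norm_add_norm_sub' (ξ x') (ξ a)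
        _ = ‖ξ a‖ * (σ S).toReal + ∫ x' in S, ‖ξ x' - ξ a‖ ∂σ := by
            rw [integral_add (integrable_const _) hξ'.norm.integrableOn, setIntegral_const,
              smul_eq_mul, mul_comm, Measure.real]
    have hmain : c₀ ≤ (lam l)⁻¹ ^ (k + 1) * (σ S).toReal := by
      rw [hc₀, div_le_iff₀ hξa']
      have h3 : (lam l) ^ (k + 1) * (β ^ (k + 1) / 2) ≤ ‖ξ a‖ * (σ S).toReal := by
        rw [mul_pow] at h1; linarith
      rw [← mul_le_mul_iff_of_pos_left htp]
      calc (lam l) ^ (k + 1) * (β ^ (k + 1) / 2) ≤ ‖ξ a‖ * (σ S).toReal := h3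
        _ = (lam l) ^ (k + 1) * ((lam l)⁻¹ ^ (k + 1) * (σ S).toReal * ‖ξ a‖) := by
            rw [inv_pow]
            field_simp
    calc ENNReal.ofReal c₀ ≤ ENNReal.ofReal ((lam l)⁻¹ ^ (k + 1) * (σ S).toReal) :=
          ENNReal.ofReal_le_ofReal hmain
      _ = σl l (closedBall 0 1) := by
          rw [ENNReal.ofReal_mul (by positivity), ENNReal.ofReal_toReal (measure_ne_top σ _)]
          simp only [hσl]
          rw [Measure.blowUp_apply_closedBall σ (k + 1) a ht 0 1, smul_zero, add_zero, mul_one]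
  have hls : limsup (fun l => σl l (closedBall 0 1)) atTop ≤ ν (closedBall 0 1) :=
    hv.limsup_measure_le_of_isCompact (isCompact_closedBall 0 1)
  have hge : ENNReal.ofReal c₀ ≤ ν (closedBall 0 1) :=
    (le_liminf_of_le (h := key)).trans
      ((liminf_le_limsup (u := fun l => σl l (closedBall 0 1))).trans hls)
  rw [hν0, Measure.coe_zero, Pi.zero_apply, nonpos_iff_eq_zero, ENNReal.ofReal_eq_zero] at hge
  exact absurd hge (not_le.2 hc₀p)

end NeZero

end Literature.Geometry.GeometricMeasureTheory
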